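import Summits.QuantumFields.YangMills.Theorems.LuscherReductionTwistedTraceScalingInnerSlowManifold
import Summits.QuantumFields.YangMills.Theorems.LuscherReductionTwistedTraceScalingCovariantCurlLipschitz
import Summits.QuantumFields.YangMills.Theorems.LuscherReductionOneSiteLevelsValleyAlgebra
import HarnessLib

/-!
# C4 INNER, brick G3b: the STIFF FORM on the slow manifold — `‖D_{constLift u} w‖² = ‖D_1 w‖² + B₁(c)(w,w) + O(|c|²‖w‖²)` with `B₁` LINEAR in the slow datum
# `c_k = 2·scalarPart(u_k)·vecPart(u_k)` and colour-rotation EQUIVARIANT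
# (lane A of S-BASE, crux `TwistedTraceScaling` stmt-QuantumFields-20203; sub-target C4-CORE, design note `pub/ym-fleet/ym-luscher-20007-p1/COARSE-DESIGN.md` §21.9, §22.5)

By G2 (`wilsonAction_stiffStep_le/ge`) the action of a stiff step `W` from `constLift u` is `L³S₁(u) + ‖D_u w‖² ± …`, `w = linkVec W`, `D_u = covCurl (constLift u)`.
Here `D_u` is expanded to SECOND order in the slow datum.  The exact quaternion rotation formula
`Ad(V)x = x + 2v₀(v⃗ × x) + 2 v⃗ × (v⃗ × x)` (`adRot_mulVec_eq`) makes the first-order part of every transport EXACTLY linear in `c_k := 2v₀(u_k)v⃗(u_k)`: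
`Ad(u_i) − 1 ↦ [c_i]_×`, `Ad(u_iu_ju_i⁻¹) − 1 ↦ [c_j]_×` (conjugation only rotates `v⃗_j` by `Ad(u_i) = 1 + O(|c|)`), `Ad(hol) − 1 ↦ 0` (the commutator
`u_iu_ju_i⁻¹u_j⁻¹` has vector part `O(|c|²)`).  Hence
* `covCurlLin c` — the linear-in-`c` operator `(D'(c)w)_{x,ij,·} = c_i × w_{x+î,j} − c_j × w_{x+ĵ,i}`; ★ `norm_covCurl_constLift_sub_sub_lin_le`:
  `‖D_u w − D_1 w − D'(c(u)) w‖ ≤ 13112·τ²·√N·‖w‖` for `|v⃗(u_k)_a| ≤ τ ≤ 1`; `norm_covCurlLin_le`: `‖D'(c)w‖ ≤ 4α√N‖w‖` for `|c_{k,a}| ≤ α`;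
* ★★ `abs_stiffForm_sub_le`: `|‖D_u w‖² − ‖D_1 w‖² − 2⟪D_1 w, D'(c(u)) w⟫| ≤ K·N·τ²·‖w‖²` (explicit `K`) — the slow–stiff potential coupling is `B₁(c)(w,w) = 2⟪D_1w, D'(c)w⟫`,
  LINEAR in `c`, plus a second-order remainder (into `η` / into the determinant bound of `…InnerSymmetry`);
* `adRot_mulVec_cross` — `Ad(g)(x × y) = Ad(g)x × Ad(g)y` (from `vecPart_mul`/`vecPart_conj`), and ★ `covCurlLin_equivariant`: `D'(Ad(g)c)(Ad(g)w) = Ad(g)(D'(c)w)`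
  for global colour rotations — with `D_1` colour-blind this is the Ad-EQUIVARIANCE of `B₁` that feeds `trace_comp_colourEquivariant_eq_zero` (brick Y): the first-order
  coupling has ZERO trace against the vacuum covariance, so it moves Gaussian determinants only at second order.
HONEST FRAMING: `3 × 3` rotation algebra on a fixed lattice; a brick of C4-CORE of the CONDITIONAL reduction route R2b1; not infinite volume, not a gap, not Clay.
-/

set_option autoImplicit false

noncomputable section

open Finset Real Module
open scoped BigOperators InnerProductSpace RealInnerProductSpace Matrix
open Literature.MathematicalPhysics.QuantumFieldTheory
open Literature.MathematicalPhysics.QuantumLattice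

namespace Summit.QuantumFields.YangMills.Theorems.FemtoTransferGap.TwoLattice.Toron

open Summit.QuantumFields.YangMills.Theorems.FemtoTransferGap
open Summit.QuantumFields.YangMills.Theorems.FemtoTransferGap.TwoLattice
open Summit.QuantumFields.YangMills.Theorems.FemtoTransferGap.TwoLattice.Stiff
open Summit.QuantumFields.YangMills.Theorems.FemtoTransferGap.TwoLattice.Cov

variable {L : ℕ} [NeZero L]

/-! ## §1 The quaternion rotation formula and cross-product bookkeeping -/

omit [NeZero L] in
/-- ★ **Quaternion rotation formula**: `Ad(V)x = x + 2v₀(v⃗ × x) + 2v⃗ × (v⃗ × x)` (`V = v₀ + v⃗·(i,j,k)`, `v₀² + |v⃗|² = 1`). [cite: BrockerTomDieck1985, I (1.10)] -/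
theorem adRot_mulVec_eq (V : SU2) (x : Fin 3 → ℝ) :
    adRot V *ᵥ x = x + (2 * scalarPart V) • (vecPart V ⨯₃ x) + (2 : ℝ) • (vecPart V ⨯₃ (vecPart V ⨯₃ x)) := by
  have h := su2_sq_sum V
  rw [scalarPart_eq]
  ext a
  fin_cases a
  · simp [adRot, Matrix.mulVec, dotProduct, Fin.sum_univ_three, cross_apply, Matrix.vecHead, Matrix.vecTail]
    linear_combination (x 0) * h
  · simp [adRot, Matrix.mulVec, dotProduct, Fin.sum_univ_three, cross_apply, Matrix.vecHead, Matrix.vecTail]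
    linear_combination (x 1) * h
  · simp [adRot, Matrix.mulVec, dotProduct, Fin.sum_univ_three, cross_apply, Matrix.vecHead, Matrix.vecTail]
    linear_combination (x 2) * h

omit [NeZero L] in
/-- `Ad(g)` preserves the cross product: `Ad(g)(x × y) = (Ad(g)x) × (Ad(g)y)` — as polynomials in the quaternion components the two sides differ by the factor
`v₀²+|v⃗|² = 1` (homogeneity `2 + 2` versus `2`). [cite: BrockerTomDieck1985, I (1.10)] -/
theorem adRot_mulVec_cross (g : SU2) (x y : Fin 3 → ℝ) : adRot g *ᵥ (x ⨯₃ y) = (adRot g *ᵥ x) ⨯₃ (adRot g *ᵥ y) := by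
  have h := su2_sq_sum g
  set p := ((g : Matrix (Fin 2) (Fin 2) ℂ) 0 0).re
  set q := ((g : Matrix (Fin 2) (Fin 2) ℂ) 0 0).im
  set r := ((g : Matrix (Fin 2) (Fin 2) ℂ) 0 1).re
  set s := ((g : Matrix (Fin 2) (Fin 2) ℂ) 0 1).im
  have key : ∀ a, ((adRot g *ᵥ x) ⨯₃ (adRot g *ᵥ y)) a = (p ^ 2 + q ^ 2 + r ^ 2 + s ^ 2) * (adRot g *ᵥ (x ⨯₃ y)) a := by
    intro a
    fin_cases a <;> simp [adRot, Matrix.mulVec, dotProduct, Fin.sum_univ_three, cross_apply, p, q, r, s] <;> ring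
  ext a
  rw [key, h, one_mul]

/-! ## §2 The linear slow datum and the linearised covariant curl -/

/-- The LINEAR slow datum of a one-site configuration: `c_k = 2·v₀(u_k)·v⃗(u_k)` (`= sin θ_k · n_k`, a chart of the hemisphere). [cite: Luscher1983, §3] -/
def slowLin (u : GaugeConfig 3 1 SU2) (k : Fin 3) : Fin 3 → ℝ := (2 * scalarPart (u (0, k))) • vecPart (u (0, k))

omit [NeZero L] in
/-- `|c_{k,a}| ≤ 2τ` when `|v⃗(u_k)_a| ≤ τ`. [folklore] -/
theorem abs_slowLin_le (u : GaugeConfig 3 1 SU2) {τ : ℝ} (hu : ∀ (k : Fin 3) (a : Fin 3), |vecPart (u (0, k)) a| ≤ τ) (k a : Fin 3) :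
    |slowLin u k a| ≤ 2 * τ := by
  unfold slowLin
  rw [Pi.smul_apply, smul_eq_mul, abs_mul, abs_mul, abs_two]
  have h1 := abs_scalarPart_le (u (0, k))
  have h2 := hu k a
  have hτ : 0 ≤ τ := (abs_nonneg _).trans h2
  nlinarith [abs_nonneg (scalarPart (u (0, k))), abs_nonneg (vecPart (u (0, k)) a)]

/-- The linearised covariant curl `D'(c)` as a map of plain functions. [cite: Luscher1983, §3] -/
def covCurlLinFun (c : Fin 3 → Fin 3 → ℝ) : (Edge 3 L × Fin 3 → ℝ) →ₗ[ℝ] (Plaquette 3 L × Fin 3 → ℝ) where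
  toFun w q := (c q.1.2.1.1 ⨯₃ fun b => w ((q.1.1.shift q.1.2.1.1, q.1.2.1.2), b)) q.2
    - (c q.1.2.1.2 ⨯₃ fun b => w ((q.1.1.shift q.1.2.1.2, q.1.2.1.1), b)) q.2
  map_add' v w := by
    funext q
    simp only [Pi.add_apply]
    rw [show (fun b => v ((q.1.1.shift q.1.2.1.1, q.1.2.1.2), b) + w ((q.1.1.shift q.1.2.1.1, q.1.2.1.2), b)) =
      (fun b => v ((q.1.1.shift q.1.2.1.1, q.1.2.1.2), b)) + fun b => w ((q.1.1.shift q.1.2.1.1, q.1.2.1.2), b) from rfl,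
      show (fun b => v ((q.1.1.shift q.1.2.1.2, q.1.2.1.1), b) + w ((q.1.1.shift q.1.2.1.2, q.1.2.1.1), b)) =
      (fun b => v ((q.1.1.shift q.1.2.1.2, q.1.2.1.1), b)) + fun b => w ((q.1.1.shift q.1.2.1.2, q.1.2.1.1), b) from rfl,
      LinearMap.map_add, LinearMap.map_add]
    simp only [Pi.add_apply]; ring
  map_smul' t w := by
    funext q
    simp only [Pi.smul_apply, smul_eq_mul, RingHom.id_apply]
    rw [show (fun b => t * w ((q.1.1.shift q.1.2.1.1, q.1.2.1.2), b)) = t • fun b => w ((q.1.1.shift q.1.2.1.1, q.1.2.1.2), b) from rfl,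
      show (fun b => t * w ((q.1.1.shift q.1.2.1.2, q.1.2.1.1), b)) = t • fun b => w ((q.1.1.shift q.1.2.1.2, q.1.2.1.1), b) from rfl,
      LinearMap.map_smul, LinearMap.map_smul]
    simp only [Pi.smul_apply, smul_eq_mul]; ring

/-- **The linearised covariant curl** `D'(c) : LinkSpace L → PlaqSpace L`, `(D'(c)w)_{x,ij} = c_i × w_{x+î,j} − c_j × w_{x+ĵ,i}`. [cite: Luscher1983, §3] -/
def covCurlLin (c : Fin 3 → Fin 3 → ℝ) : LinkSpace L →ₗ[ℝ] PlaqSpace L :=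
  (WithLp.linearEquiv 2 ℝ (Plaquette 3 L × Fin 3 → ℝ)).symm.toLinearMap ∘ₗ covCurlLinFun c ∘ₗ
    (WithLp.linearEquiv 2 ℝ (Edge 3 L × Fin 3 → ℝ)).toLinearMap

omit [NeZero L] in
/-- Components of `D'(c)w`. [cite: Luscher1983, §3] -/
theorem covCurlLin_apply (c : Fin 3 → Fin 3 → ℝ) (w : LinkSpace L) (x : Site 3 L) (ij : {q : Fin 3 × Fin 3 // q.1 < q.2}) (a : Fin 3) :
    covCurlLin c w ((x, ij), a) =
      (c ij.1.1 ⨯₃ fun b => w ((x.shift ij.1.1, ij.1.2), b)) a - (c ij.1.2 ⨯₃ fun b => w ((x.shift ij.1.2, ij.1.1), b)) a := by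
  simp [covCurlLin, covCurlLinFun]

/-- `‖D'(c) w‖ ≤ 4α·√N·‖w‖` for `|c_{k,a}| ≤ α`. [cite: Luscher1983, §3] -/
theorem norm_covCurlLin_le {c : Fin 3 → Fin 3 → ℝ} {α : ℝ} (hc : ∀ k a, |c k a| ≤ α) (w : LinkSpace L) :
    ‖covCurlLin c w‖ ≤ 4 * α * Real.sqrt (Fintype.card (Plaquette 3 L × Fin 3)) * ‖w‖ := by
  have hα : 0 ≤ α := (abs_nonneg _).trans (hc 0 0)
  have hq : ∀ q : Plaquette 3 L × Fin 3, |covCurlLin c w q| ≤ 4 * α * ‖w‖ := by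
    rintro ⟨⟨x, ij⟩, a⟩
    rw [covCurlLin_apply]
    have h1 := abs_cross_apply_le (hc ij.1.1) (fun b => abs_apply_le_norm w (x.shift ij.1.1, ij.1.2) b) a
    have h2 := abs_cross_apply_le (hc ij.1.2) (fun b => abs_apply_le_norm w (x.shift ij.1.2, ij.1.1) b) a
    refine (abs_sub _ _).trans ?_
    linarith
  have h := norm_le_sqrt_card_mul (by positivity : (0 : ℝ) ≤ 4 * α * ‖w‖) hq
  linarith [h]

/-! ## §3 Second-order bookkeeping for one adjoint rotation -/

omit [NeZero L] in
/-- `Ad(V)y − y − 2v₀(v⃗ × y) = 2v⃗ × (v⃗ × y)`. [cite: BrockerTomDieck1985, I (1.10)] -/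
theorem adRot_mulVec_sub_lin (V : SU2) (y : Fin 3 → ℝ) :
    adRot V *ᵥ y - y - (2 * scalarPart V) • (vecPart V ⨯₃ y) = (2 : ℝ) • (vecPart V ⨯₃ (vecPart V ⨯₃ y)) := by
  rw [adRot_mulVec_eq]; abel

omit [NeZero L] in
/-- Second-order remainder of one rotation: `|(Ad(V)y − y − 2v₀ v⃗×y)_a| ≤ 8σ²ρ` for `|v⃗_c| ≤ σ`, `|y_c| ≤ ρ`. [folklore] -/
theorem abs_adRot_mulVec_sub_lin_le {V : SU2} {y : Fin 3 → ℝ} {σ ρ : ℝ} (hv : ∀ c, |vecPart V c| ≤ σ) (hy : ∀ c, |y c| ≤ ρ) (a : Fin 3) :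
    |(adRot V *ᵥ y - y - (2 * scalarPart V) • (vecPart V ⨯₃ y)) a| ≤ 8 * σ ^ 2 * ρ := by
  rw [adRot_mulVec_sub_lin, Pi.smul_apply, smul_eq_mul, abs_mul, abs_two]
  have h1 : ∀ c, |(vecPart V ⨯₃ y) c| ≤ 2 * σ * ρ := fun c => abs_cross_apply_le hv hy c
  have h2 := abs_cross_apply_le hv h1 a
  nlinarith [h2]

omit [NeZero L] in
/-- First-order size of one rotation: `|(Ad(V)y − y)_a| ≤ 4σρ + 8σ²ρ`. [folklore] -/
theorem abs_adRot_mulVec_sub_le {V : SU2} {y : Fin 3 → ℝ} {σ ρ : ℝ} (hv : ∀ c, |vecPart V c| ≤ σ) (hy : ∀ c, |y c| ≤ ρ) (a : Fin 3) :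
    |(adRot V *ᵥ y - y) a| ≤ 4 * σ * ρ + 8 * σ ^ 2 * ρ := by
  have h1 := abs_adRot_mulVec_sub_lin_le hv hy a
  have h2 : |((2 * scalarPart V) • (vecPart V ⨯₃ y)) a| ≤ 4 * σ * ρ := by
    rw [Pi.smul_apply, smul_eq_mul, abs_mul, abs_mul, abs_two]
    have h3 := abs_cross_apply_le hv hy a
    have h4 := abs_scalarPart_le V
    have hσρ : 0 ≤ σ * ρ := by
      have := (abs_nonneg _).trans h3; linarith
    nlinarith [abs_nonneg (scalarPart V)]
  have e : (adRot V *ᵥ y - y) a = (adRot V *ᵥ y - y - (2 * scalarPart V) • (vecPart V ⨯₃ y)) a + ((2 * scalarPart V) • (vecPart V ⨯₃ y)) a := by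
    simp only [Pi.sub_apply]; ring
  rw [e]
  exact (abs_add_le _ _).trans (by linarith)

/-! ## §4 The transports of the slow manifold and the second-order expansion of `D_u` -/

omit [NeZero L] in
/-- The transports of `constLift u` at a plaquette in the `(i,j)` plane: `P₁ = u_i`, `P₂ = u_iu_ju_i⁻¹`, `hol = u_iu_ju_i⁻¹u_j⁻¹`. [folklore] -/
theorem transports_constLift (u : GaugeConfig 3 1 SU2) (x : Site 3 L) (ij : {q : Fin 3 × Fin 3 // q.1 < q.2}) :
    ptrans1 (constLift L u) (x, ij) = u (0, ij.1.1) ∧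
      ptrans2 (constLift L u) (x, ij) = u (0, ij.1.1) * u (0, ij.1.2) * (u (0, ij.1.1))⁻¹ ∧
      hol (constLift L u) (x, ij) = u (0, ij.1.1) * u (0, ij.1.2) * (u (0, ij.1.1))⁻¹ * (u (0, ij.1.2))⁻¹ := by
  refine ⟨rfl, ?_, ?_⟩
  · simp [ptrans2, constLift_apply]
  · simp [hol, plaquetteHolonomy, constLift_apply]

omit [NeZero L] in
/-- Components of the vacuum curl `D_1 w`. [folklore] -/
theorem covCurl_one_apply (w : LinkSpace L) (x : Site 3 L) (ij : {q : Fin 3 × Fin 3 // q.1 < q.2}) (a : Fin 3) :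
    covCurl (1 : GaugeConfig 3 L SU2) w ((x, ij), a) =
      w ((x, ij.1.1), a) + w ((x.shift ij.1.1, ij.1.2), a) - w ((x.shift ij.1.2, ij.1.1), a) - w ((x, ij.1.2), a) := by
  have h1 : ptrans1 (1 : GaugeConfig 3 L SU2) (x, ij) = 1 := rfl
  have h2 : ptrans2 (1 : GaugeConfig 3 L SU2) (x, ij) = 1 := by simp [ptrans2]
  have h3 : hol (1 : GaugeConfig 3 L SU2) (x, ij) = 1 := by simp [hol, plaquetteHolonomy]
  rw [covCurl_apply, h1, h2, h3, adRot_one]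
  simp only [Matrix.one_apply, ite_mul, one_mul, zero_mul, Finset.sum_ite_eq, Finset.mem_univ, if_true]

omit [NeZero L] in
/-- A transported term as a matrix–vector product. [folklore] -/
theorem sum_adRot_mul_eq_mulVec (V : SU2) (y : Fin 3 → ℝ) (a : Fin 3) : ∑ b, adRot V a b * y b = (adRot V *ᵥ y) a := rfl

/-- ★ **SECOND-ORDER EXPANSION OF THE COVARIANT CURL ON THE SLOW MANIFOLD**, componentwise: for `|v⃗(u_k)_a| ≤ τ ≤ 1`,
`|(D_u w − D_1 w − D'(c(u)) w)_{p,a}| ≤ 11920·τ²·‖w‖`. [cite: Luscher1983, §3] -/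
theorem abs_covCurl_constLift_sub_sub_lin_le (u : GaugeConfig 3 1 SU2) {τ : ℝ} (hτ1 : τ ≤ 1)
    (hu : ∀ (k : Fin 3) (a : Fin 3), |vecPart (u (0, k)) a| ≤ τ) (w : LinkSpace L) (x : Site 3 L) (ij : {q : Fin 3 × Fin 3 // q.1 < q.2}) (a : Fin 3) :
    |(covCurl (constLift L u) w - covCurl 1 w - covCurlLin (slowLin u) w) ((x, ij), a)| ≤ 11920 * τ ^ 2 * ‖w‖ := by
  have hτ0 : 0 ≤ τ := (abs_nonneg _).trans (hu 0 0)
  set i := ij.1.1 with hi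
  set j := ij.1.2 with hj
  set ui := u (0, i) with hui
  set uj := u (0, j) with huj
  set w₁ : Fin 3 → ℝ := fun b => w ((x.shift i, j), b) with hw₁
  set w₂ : Fin 3 → ℝ := fun b => w ((x.shift j, i), b) with hw₂
  set w₃ : Fin 3 → ℝ := fun b => w ((x, j), b) with hw₃
  set ρ := ‖w‖ with hρ
  have hw₁b : ∀ c, |w₁ c| ≤ ρ := fun c => abs_apply_le_norm w _ c
  have hw₂b : ∀ c, |w₂ c| ≤ ρ := fun c => abs_apply_le_norm w _ c
  have hw₃b : ∀ c, |w₃ c| ≤ ρ := fun c => abs_apply_le_norm w _ c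
  have hρ0 : 0 ≤ ρ := norm_nonneg _
  obtain ⟨hP1, hP2, hP3⟩ := transports_constLift (L := L) u x ij
  -- the conjugated link `ũ = u_i u_j u_i⁻¹` and the holonomy `h = ũ u_j⁻¹`
  set ut := ui * uj * ui⁻¹ with hut
  set δ : Fin 3 → ℝ := adRot ui *ᵥ vecPart uj - vecPart uj with hδ
  have hs_ut : scalarPart ut = scalarPart uj := scalarPart_conj ui uj
  have hv_ut : vecPart ut = vecPart uj + δ := by rw [hut, vecPart_conj, hδ]; abel
  have hδb : ∀ c, |δ c| ≤ 12 * τ ^ 2 := fun c => by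
    have := abs_adRot_mulVec_sub_le (hu i) (hu j) c
    rw [hδ]; nlinarith
  have hvutb : ∀ c, |vecPart ut c| ≤ 13 * τ := fun c => by
    rw [hv_ut, Pi.add_apply]
    refine (abs_add_le _ _).trans ?_
    have := hu j c; have := hδb c; nlinarith
  set h := ut * uj⁻¹ with hh
  have hv_h : vecPart h = scalarPart uj • δ - δ ⨯₃ vecPart uj := by
    rw [hh, vecPart_mul, scalarPart_inv, vecPart_inv, hs_ut, hv_ut, smul_neg, LinearMap.map_neg, LinearMap.map_add]
    simp only [LinearMap.add_apply, cross_self, zero_add, smul_add]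
    abel
  have hvhb : ∀ c, |vecPart h c| ≤ 36 * τ ^ 2 := fun c => by
    rw [hv_h, Pi.sub_apply, Pi.smul_apply, smul_eq_mul]
    refine (abs_sub _ _).trans ?_
    rw [abs_mul]
    have h1 := abs_scalarPart_le uj
    have h2 := hδb c
    have h3 := abs_cross_apply_le hδb (hu j) c
    nlinarith [abs_nonneg (scalarPart uj), abs_nonneg (δ c)]
  -- the three remainders
  have R1 := abs_adRot_mulVec_sub_lin_le (hu i) hw₁b a
  have R2a := abs_adRot_mulVec_sub_lin_le hvutb hw₂b a
  have R2b : |((2 * scalarPart uj) • (δ ⨯₃ w₂)) a| ≤ 48 * τ ^ 2 * ρ := by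
    rw [Pi.smul_apply, smul_eq_mul, abs_mul, abs_mul, abs_two]
    have h3 := abs_cross_apply_le hδb hw₂b a
    have h4 := abs_scalarPart_le uj
    nlinarith [abs_nonneg (scalarPart uj), abs_nonneg ((δ ⨯₃ w₂) a)]
  have R3 := abs_adRot_mulVec_sub_le hvhb hw₃b a
  -- the component identity
  have hlin : covCurlLin (slowLin u) w ((x, ij), a) = ((2 * scalarPart ui) • (vecPart ui ⨯₃ w₁)) a - ((2 * scalarPart uj) • (vecPart uj ⨯₃ w₂)) a := by
    rw [covCurlLin_apply]
    simp only [slowLin, LinearMap.map_smul, LinearMap.smul_apply, hui, huj, hw₁, hw₂, hi, hj]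
  have hcomp : (covCurl (constLift L u) w - covCurl 1 w - covCurlLin (slowLin u) w) ((x, ij), a) =
      (adRot ui *ᵥ w₁ - w₁ - (2 * scalarPart ui) • (vecPart ui ⨯₃ w₁)) a
      - ((adRot ut *ᵥ w₂ - w₂ - (2 * scalarPart ut) • (vecPart ut ⨯₃ w₂)) a + (2 * scalarPart uj) • (δ ⨯₃ w₂) a)
      - (adRot h *ᵥ w₃ - w₃) a := by
    rw [PiLp.sub_apply, PiLp.sub_apply, covCurl_apply, covCurl_one_apply, hlin, hP1, hP2, hP3,
      sum_adRot_mul_eq_mulVec, sum_adRot_mul_eq_mulVec, sum_adRot_mul_eq_mulVec]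
    simp only [Pi.sub_apply, Pi.smul_apply, Pi.add_apply, smul_eq_mul, hs_ut, hv_ut, LinearMap.map_add, LinearMap.add_apply,
      ← hui, hw₁, hw₂, hw₃, ← hi, ← hj]
    ring
  rw [hcomp]
  have hs2 : |(2 * scalarPart uj) • (δ ⨯₃ w₂) a| ≤ 48 * τ ^ 2 * ρ := by simpa [Pi.smul_apply] using R2b
  calc |(adRot ui *ᵥ w₁ - w₁ - (2 * scalarPart ui) • (vecPart ui ⨯₃ w₁)) a
        - ((adRot ut *ᵥ w₂ - w₂ - (2 * scalarPart ut) • (vecPart ut ⨯₃ w₂)) a + (2 * scalarPart uj) • (δ ⨯₃ w₂) a)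
        - (adRot h *ᵥ w₃ - w₃) a|
      ≤ |(adRot ui *ᵥ w₁ - w₁ - (2 * scalarPart ui) • (vecPart ui ⨯₃ w₁)) a|
        + (|(adRot ut *ᵥ w₂ - w₂ - (2 * scalarPart ut) • (vecPart ut ⨯₃ w₂)) a| + |(2 * scalarPart uj) • (δ ⨯₃ w₂) a|)
        + |(adRot h *ᵥ w₃ - w₃) a| := by
          refine (abs_sub _ _).trans (add_le_add ((abs_sub _ _).trans (add_le_add le_rfl (abs_add_le _ _))) le_rfl)
    _ ≤ 8 * τ ^ 2 * ρ + (8 * (13 * τ) ^ 2 * ρ + 48 * τ ^ 2 * ρ) + (4 * (36 * τ ^ 2) * ρ + 8 * (36 * τ ^ 2) ^ 2 * ρ) := by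
          gcongr
    _ ≤ 11920 * τ ^ 2 * ρ := by
          have hτ2 : τ ^ 2 ≤ 1 := by nlinarith
          nlinarith [mul_nonneg (mul_nonneg (sq_nonneg τ) (sq_nonneg τ)) hρ0, mul_nonneg (sq_nonneg τ) hρ0]

/-- ★ **Norm form**: `‖D_u w − D_1 w − D'(c(u)) w‖ ≤ 11920·τ²·√N·‖w‖` (`N = 3|P|`). [cite: Luscher1983, §3] -/
theorem norm_covCurl_constLift_sub_sub_lin_le (u : GaugeConfig 3 1 SU2) {τ : ℝ} (hτ1 : τ ≤ 1)
    (hu : ∀ (k : Fin 3) (a : Fin 3), |vecPart (u (0, k)) a| ≤ τ) (w : LinkSpace L) :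
    ‖covCurl (constLift L u) w - covCurl 1 w - covCurlLin (slowLin u) w‖ ≤
      11920 * τ ^ 2 * Real.sqrt (Fintype.card (Plaquette 3 L × Fin 3)) * ‖w‖ := by
  have hq : ∀ q : Plaquette 3 L × Fin 3, |(covCurl (constLift L u) w - covCurl 1 w - covCurlLin (slowLin u) w) q| ≤ 11920 * τ ^ 2 * ‖w‖ := by
    rintro ⟨⟨x, ij⟩, a⟩
    exact abs_covCurl_constLift_sub_sub_lin_le u hτ1 hu w x ij a
  have h := norm_le_sqrt_card_mul (by positivity : (0 : ℝ) ≤ 11920 * τ ^ 2 * ‖w‖) hq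
  linarith [h]

/-! ## §5 The stiff form: `‖D_u w‖² = ‖D_1 w‖² + B₁(c)(w,w) + O(|c|²‖w‖²)` -/

/-- ★★ **THE STIFF FORM ON THE SLOW MANIFOLD TO SECOND ORDER**: for `|v⃗(u_k)_a| ≤ τ ≤ 1`,
`|‖D_u w‖² − ‖D_1 w‖² − 2⟪D_1 w, D'(c(u)) w⟫| ≤ 1.45·10⁸ · N · τ² · ‖w‖²` — the slow–stiff potential coupling is the LINEAR-in-`c` form `B₁(c)(w,w) = 2⟪D_1w, D'(c)w⟫`
plus a second-order remainder. [cite: Luscher1983, §3] -/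
theorem abs_stiffForm_sub_le (u : GaugeConfig 3 1 SU2) {τ : ℝ} (hτ1 : τ ≤ 1)
    (hu : ∀ (k : Fin 3) (a : Fin 3), |vecPart (u (0, k)) a| ≤ τ) (w : LinkSpace L) :
    |‖covCurl (constLift L u) w‖ ^ 2 - ‖covCurl 1 w‖ ^ 2 - 2 * ⟪covCurl 1 w, covCurlLin (slowLin u) w⟫_ℝ| ≤
      145000000 * (Fintype.card (Plaquette 3 L × Fin 3) : ℝ) * τ ^ 2 * ‖w‖ ^ 2 := by
  have hτ0 : 0 ≤ τ := (abs_nonneg _).trans (hu 0 0)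
  set N : ℝ := (Fintype.card (Plaquette 3 L × Fin 3) : ℝ) with hN
  set A := covCurl (1 : GaugeConfig 3 L SU2) w with hA
  set B := covCurlLin (slowLin u) w with hB
  set C := covCurl (constLift L u) w - A - B with hC
  have hsum : covCurl (constLift L u) w = A + (B + C) := by rw [hC]; abel
  have hAn : ‖A‖ ≤ 10 * Real.sqrt N * ‖w‖ := norm_covCurl_le_op 1 w
  have hBn : ‖B‖ ≤ 4 * (2 * τ) * Real.sqrt N * ‖w‖ := norm_covCurlLin_le (abs_slowLin_le u hu) w
  have hCn : ‖C‖ ≤ 11920 * τ ^ 2 * Real.sqrt N * ‖w‖ := norm_covCurl_constLift_sub_sub_lin_le u hτ1 hu w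
  have hsN : Real.sqrt N ^ 2 = N := Real.sq_sqrt (by positivity)
  have e : ‖covCurl (constLift L u) w‖ ^ 2 - ‖A‖ ^ 2 - 2 * ⟪A, B⟫_ℝ = 2 * ⟪A, C⟫_ℝ + ‖B + C‖ ^ 2 := by
    rw [hsum, norm_add_sq_real, norm_add_sq_real, inner_add_right]; ring
  rw [e]
  have h1 : |⟪A, C⟫_ℝ| ≤ ‖A‖ * ‖C‖ := abs_real_inner_le_norm _ _
  have h2 : ‖B + C‖ ^ 2 ≤ (‖B‖ + ‖C‖) ^ 2 := pow_le_pow_left₀ (norm_nonneg _) (norm_add_le _ _) 2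
  have hAC : ‖A‖ * ‖C‖ ≤ (10 * Real.sqrt N * ‖w‖) * (11920 * τ ^ 2 * Real.sqrt N * ‖w‖) :=
    mul_le_mul hAn hCn (norm_nonneg _) (by positivity)
  have hBC : ‖B‖ + ‖C‖ ≤ (8 * τ + 11920 * τ ^ 2) * Real.sqrt N * ‖w‖ := by nlinarith
  have hBC2 : (‖B‖ + ‖C‖) ^ 2 ≤ ((8 * τ + 11920 * τ ^ 2) * Real.sqrt N * ‖w‖) ^ 2 := pow_le_pow_left₀ (by positivity) hBC 2
  have hτ2 : τ ^ 2 ≤ τ := by nlinarith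
  refine (abs_add_le _ _).trans ?_
  rw [abs_of_nonneg (sq_nonneg ‖B + C‖), abs_mul, abs_two]
  have h3 : ((8 * τ + 11920 * τ ^ 2) * Real.sqrt N * ‖w‖) ^ 2 ≤ 11928 ^ 2 * N * τ ^ 2 * ‖w‖ ^ 2 := by
    have h4 : 8 * τ + 11920 * τ ^ 2 ≤ 11928 * τ := by nlinarith
    have h5 : 0 ≤ 8 * τ + 11920 * τ ^ 2 := by positivity
    calc ((8 * τ + 11920 * τ ^ 2) * Real.sqrt N * ‖w‖) ^ 2 = (8 * τ + 11920 * τ ^ 2) ^ 2 * Real.sqrt N ^ 2 * ‖w‖ ^ 2 := by ring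
      _ = (8 * τ + 11920 * τ ^ 2) ^ 2 * N * ‖w‖ ^ 2 := by rw [hsN]
      _ ≤ (11928 * τ) ^ 2 * N * ‖w‖ ^ 2 := by gcongr
      _ = 11928 ^ 2 * N * τ ^ 2 * ‖w‖ ^ 2 := by ring
  have h6 : (10 * Real.sqrt N * ‖w‖) * (11920 * τ ^ 2 * Real.sqrt N * ‖w‖) = 119200 * N * τ ^ 2 * ‖w‖ ^ 2 := by
    rw [show (10 * Real.sqrt N * ‖w‖) * (11920 * τ ^ 2 * Real.sqrt N * ‖w‖) = 119200 * Real.sqrt N ^ 2 * τ ^ 2 * ‖w‖ ^ 2 by ring, hsN]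
  nlinarith [h1, h2, hAC, hBC2, h3, h6, sq_nonneg ‖w‖, mul_nonneg (mul_nonneg (by positivity : (0:ℝ) ≤ N) (sq_nonneg τ)) (sq_nonneg ‖w‖)]

/-! ## §6 Colour-rotation equivariance of the first-order coupling -/

omit [NeZero L] in
/-- ★ **`D'` is colour-rotation EQUIVARIANT**: if `w'` is `w` with every colour vector rotated by `Ad(g)`, then `D'(Ad(g)c) w'` is `D'(c) w` rotated by `Ad(g)`.  With the
colour-blind `D_1` this makes `B₁(c)(w,w) = 2⟪D_1w, D'(c)w⟫` Ad-equivariant — the hypothesis of `trace_comp_colourEquivariant_eq_zero` (brick Y). [cite: Luscher1983, §3] -/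
theorem covCurlLin_equivariant (g : SU2) (c : Fin 3 → Fin 3 → ℝ) (w w' : LinkSpace L)
    (hw' : ∀ e : Edge 3 L, (fun b => w' (e, b)) = adRot g *ᵥ fun b => w (e, b)) (x : Site 3 L) (ij : {q : Fin 3 × Fin 3 // q.1 < q.2}) :
    (fun a => covCurlLin (fun k => adRot g *ᵥ c k) w' ((x, ij), a)) = adRot g *ᵥ fun a => covCurlLin c w ((x, ij), a) := by
  have e1 : (fun a => covCurlLin c w ((x, ij), a)) =
      (c ij.1.1 ⨯₃ fun b => w ((x.shift ij.1.1, ij.1.2), b)) - (c ij.1.2 ⨯₃ fun b => w ((x.shift ij.1.2, ij.1.1), b)) := by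
    funext a; rw [covCurlLin_apply, Pi.sub_apply]
  have e2 : (fun a => covCurlLin (fun k => adRot g *ᵥ c k) w' ((x, ij), a)) =
      ((adRot g *ᵥ c ij.1.1) ⨯₃ fun b => w' ((x.shift ij.1.1, ij.1.2), b)) - ((adRot g *ᵥ c ij.1.2) ⨯₃ fun b => w' ((x.shift ij.1.2, ij.1.1), b)) := by
    funext a; rw [covCurlLin_apply, Pi.sub_apply]
  rw [e1, e2, hw', hw', Matrix.mulVec_sub, adRot_mulVec_cross, adRot_mulVec_cross]

end Summit.QuantumFields.YangMills.Theorems.FemtoTransferGap.TwoLattice.Toron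

end
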